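import Literature.NumberTheory.Transcendental.IntegerTaylor
import Mathlib.RingTheory.MvPowerSeries.Inverse
import Mathlib.RingTheory.Localization.AtPrime.Basic
import Mathlib.RingTheory.Ideal.Operations
import HarnessLib

/-!
# A polynomial of degree `δ` has `𝔮`-adic order `≤ δ` at every prime (Hasse–Schmidt / Taylor argument)

Topic: `Literature/AlgebraicGeometry/Resolution`. A characteristic-free local fact about affine
space used in Hironaka's fundamental inequality for the order of the weak transform under the
blowing up of a closed point ([CoP1] = Cossart–Piltant, J. Algebra 320 (2008), proof of
Prop. 4.2, statement (a) p. 8: "for any point `x′` above `x`, `ord_{x′} J′ ≤ μ`", obtained from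
(11): "`y₁^{-μ} f ≡ F(1, y₂′, y₃′) mod (y₁′)` … since `ord_{x′} J′ ≤ deg F = μ`"): for the
dehomogenised initial form `F(1, T)`, a NON-ZERO polynomial of degree `≤ μ` over the residue
field, one needs that its order at an ARBITRARY point of the exceptional divisor (closed or not,
with any residue field extension) is at most its degree:

**Theorem** (`algebraMap_mvPolynomial_not_mem_maximalIdeal_pow`). Let `k` be a field,
`g ∈ k[T_i : i ∈ σ]` non-zero of total degree `δ`, `𝔮` a prime ideal and `S = k[T]_𝔮`. Then
`g ∉ 𝔮^e S` for every `e > δ`; i.e. `ord_𝔮(g) ≤ deg g`.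

Proof (Hasse–Schmidt derivatives, valid in every characteristic): the Taylor homomorphism
`τ : k[T] → k[T][Y]`, `T_i ↦ T_i + Y_i` — in the tree: `Literature.NumberTheory.Transcendental.Taylor.shift`
with `Y`-coefficients `Taylor.taylorCoeff β g` (the Hasse–Schmidt derivatives `D^{[β]} g`) and
the bidegree bookkeeping `Taylor.bidegLE_shift` (`IntegerTaylor.lean`, Diaz 1989) — satisfies,
for `|β| ≥ δ`, `taylorCoeff β g = C (coeff_{T^β} g)` (the one corollary added here). Composed
with `k[T][Y] → S⟦Y⟧`, `τ` extends to `τ̂ : S → S⟦Y⟧` (elements outside `𝔮` become power series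
with unit constant term), a ring homomorphism with `constantCoeff ∘ τ̂ = id`; for ANY such
homomorphism the components `D̂^{[β]} = coeff_β ∘ τ̂` satisfy the Leibniz rule and hence
`D̂^{[β]}(I^e) ⊆ I^{e-|β|}` for every ideal `I`. With `I = 𝔮 S` and `|β| = δ`, `coeff_{T^β} g = c ≠ 0`:
`g ∈ 𝔮^e S` would give the unit `c = D̂^{[β]} g ∈ 𝔮^{e-δ} S ⊆ 𝔮 S`, absurd.

* `hsComponent φ β` — the components of a "Hasse–Schmidt homomorphism" `φ : B → B⟦Y⟧`;
  `hsComponent_mul` (Leibniz), `hsComponent_mem_pow` (**`D^{[β]}(I^e) ⊆ I^{e-|β|}`**) — not in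
  the tree (`IntegerTaylor.lean` has the Leibniz rule for `taylorCoeff` on polynomials only;
  the localisation step needs the `B → B⟦Y⟧` form);
* `Taylor.map_constantCoeff_shift` (`(kill T) ∘ τ = id`) and
  `Taylor.taylorCoeff_eq_C_coeff_of_totalDegree_le` (**top Hasse–Schmidt derivatives are the
  top coefficients**) — corollaries of `IntegerTaylor.lean`;
* `algebraMap_mvPolynomial_not_mem_maximalIdeal_pow` — the theorem.

Tree search: `Literature.NumberTheory.Transcendental.Taylor.shift` / `taylorCoeff` / `BidegLE` /
`bidegLE_shift` / `totalDegree_taylorCoeff_add_degree_le` (reused); Mathlib `Polynomial.hasseDeriv`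
(one variable only), `MvPowerSeries.coeff_mul`, `MvPowerSeries.isUnit_iff_constantCoeff`,
`IsLocalization.lift` (used).

## Sources

* V. Cossart, O. Piltant, J. Algebra 320 (2008), proof of Prop. 4.2, (10)–(11) and (a), p. 8
  (the application). [CossartPiltant2008]
* H. Matsumura, *Commutative Ring Theory* (1986), §27 (higher derivations; Hasse–Schmidt).
  [Matsumura1987]
* G. Diaz, J. Number Theory 31 (1989), §II-3 — the source of the tree's `Taylor.shift` /
  `taylorCoeff` (integer Taylor coefficients), reused here. [Diaz1989]
-/

noncomputable section

namespace Literature.AlgebraicGeometry.Resolution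

open Finsupp

/-! ## Components of a Hasse–Schmidt homomorphism `B → B⟦Y⟧` -/

section HasseSchmidt

variable {B : Type*} [CommRing B] {σ : Type*}

/-- The `β`-component `D^{[β]} b := coeff_{Y^β} φ(b)` of a ring homomorphism `φ : B → B⟦Y⟧`
(a Hasse–Schmidt derivation when `constantCoeff ∘ φ = id`; Matsumura §27).
[cite: Matsumura1987, §27 (higher derivations)] -/
def hsComponent (φ : B →+* MvPowerSeries σ B) (β : σ →₀ ℕ) (b : B) : B :=
  MvPowerSeries.coeff β (φ b)

/-- Components are additive. [folklore] -/
theorem hsComponent_add (φ : B →+* MvPowerSeries σ B) (β : σ →₀ ℕ) (a b : B) :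
    hsComponent φ β (a + b) = hsComponent φ β a + hsComponent φ β b := by
  simp [hsComponent]

/-- **Leibniz rule**: `D^{[β]}(ab) = ∑_{γ + γ' = β} D^{[γ]}(a) D^{[γ']}(b)`.
[cite: Matsumura1987, §27 (higher derivations)] -/
theorem hsComponent_mul [DecidableEq σ] (φ : B →+* MvPowerSeries σ B) (β : σ →₀ ℕ) (a b : B) :
    hsComponent φ β (a * b) =
      ∑ p ∈ Finset.antidiagonal β, hsComponent φ p.1 a * hsComponent φ p.2 b := by
  simp only [hsComponent, map_mul, MvPowerSeries.coeff_mul]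

/-- The `0`-component is the identity when `constantCoeff ∘ φ = id`. [folklore] -/
theorem hsComponent_zero (φ : B →+* MvPowerSeries σ B)
    (hφ : ∀ b, MvPowerSeries.constantCoeff (φ b) = b) (b : B) : hsComponent φ 0 b = b := by
  rw [hsComponent, MvPowerSeries.coeff_zero_eq_constantCoeff_apply]
  exact hφ b

/-- **`D^{[β]}(I^e) ⊆ I^{e - |β|}`** for the components of a Hasse–Schmidt homomorphism and any
ideal `I` (Leibniz rule, induction on `e`). [cite: Matsumura1987, §27 (higher derivations)] -/
theorem hsComponent_mem_pow (φ : B →+* MvPowerSeries σ B)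
    (hφ : ∀ b, MvPowerSeries.constantCoeff (φ b) = b) (I : Ideal B) :
    ∀ (e : ℕ) (β : σ →₀ ℕ) {b : B}, b ∈ I ^ e → hsComponent φ β b ∈ I ^ (e - degree β) := by
  classical
  intro e
  induction e with
  | zero => intro β b _; simp
  | succ e ih =>
    intro β b hb
    rw [pow_succ'] at hb
    refine Submodule.mul_induction_on hb (fun m hm n hn => ?_) (fun x y hx hy => ?_)
    · rw [hsComponent_mul]
      refine sum_mem fun p hp => ?_
      have hdeg : degree p.1 + degree p.2 = degree β := by
        rw [← map_add, Finset.mem_antidiagonal.mp hp]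
      have h2 : hsComponent φ p.2 n ∈ I ^ (e - degree p.2) := ih p.2 hn
      by_cases h0 : p.1 = 0
      · -- `D^{[0]} m = m ∈ I`
        have h1 : hsComponent φ p.1 m ∈ I ^ 1 := by
          rw [h0, hsComponent_zero φ hφ, pow_one]; exact hm
        have := Ideal.mul_mem_mul h1 h2
        rw [← pow_add] at this
        refine Ideal.pow_le_pow_right ?_ this
        rw [h0, map_zero, zero_add] at hdeg
        omega
      · have h1 : 1 ≤ degree p.1 := by
          rw [Nat.one_le_iff_ne_zero, Ne, degree_eq_zero_iff]
          exact h0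
        have := Ideal.mul_mem_left _ (hsComponent φ p.1 m) h2
        refine Ideal.pow_le_pow_right ?_ this
        omega
    · rw [hsComponent_add]
      exact Ideal.add_mem _ hx hy

end HasseSchmidt

/-! ## Top Taylor coefficients (corollaries of `IntegerTaylor.lean`) -/

section Taylor

open Literature.NumberTheory.Transcendental

variable {R : Type*} [CommRing R] {σ : Type*}

/-- **Setting `T = 0` in the coefficients undoes the Taylor shift**: `(kill T) ∘ shift = id`,
i.e. `g(T) = ∑_β (taylorCoeff β g)(0) T^β`. [folklore] -/
theorem Taylor.map_constantCoeff_shift (g : MvPolynomial σ R) :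
    MvPolynomial.map MvPolynomial.constantCoeff (Taylor.shift g) = g := by
  have : (MvPolynomial.map MvPolynomial.constantCoeff).comp
      (Taylor.shift : MvPolynomial σ R →ₐ[R] _).toRingHom = RingHom.id _ := by
    refine MvPolynomial.ringHom_ext (fun a => ?_) (fun i => ?_)
    · simp
    · simp
  exact RingHom.congr_fun this g

/-- **Top Hasse–Schmidt derivatives are the top coefficients**: for `|β| ≥ deg g`, the Taylor
coefficient `taylorCoeff β g` (the `Y^β`-coefficient of `g(T + Y)`) is the constant
`coeff_{T^β} g` (bidegree count `Taylor.bidegLE_shift`: its `T`-degree is `≤ deg g - |β| = 0`,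
and its constant term is `coeff_β g` by `map_constantCoeff_shift`). [folklore] -/
theorem Taylor.taylorCoeff_eq_C_coeff_of_totalDegree_le [DecidableEq σ] (g : MvPolynomial σ R)
    {β : σ →₀ ℕ} (hβ : g.totalDegree ≤ degree β) :
    Taylor.taylorCoeff β g = MvPolynomial.C (MvPolynomial.coeff β g) := by
  -- `taylorCoeff β g` is a constant …
  have hdeg : (Taylor.taylorCoeff β g).totalDegree = 0 := by
    by_cases h0 : Taylor.taylorCoeff β g = 0
    · rw [h0, MvPolynomial.totalDegree_zero]
    · have := Taylor.totalDegree_taylorCoeff_add_degree_le β g h0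
      omega
  rw [MvPolynomial.totalDegree_eq_zero_iff_eq_C] at hdeg
  -- … with constant term `coeff β g`
  have h2 : MvPolynomial.coeff 0 (Taylor.taylorCoeff β g) = MvPolynomial.coeff β g := by
    have := congrArg (MvPolynomial.coeff β) (Taylor.map_constantCoeff_shift g)
    rw [MvPolynomial.coeff_map] at this
    rw [← this]
    rfl
  rw [hdeg, h2]

end Taylor

/-! ## The order of a polynomial at a prime is at most its degree -/

section Order

open Literature.NumberTheory.Transcendental

variable {k : Type*} [Field k] {σ : Type*}

/-- **`ord_𝔮(g) ≤ deg g`**: a non-zero polynomial `g` over a field does not lie in `𝔮^e k[T]_𝔮`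
for any prime `𝔮` and any `e > deg g` — the order of `g` at every point of affine space
(closed or not) is at most its total degree. Characteristic-free, via Hasse–Schmidt
derivatives extended to the localisation. (The fact behind [CoP1] (a), p. 8:
"`ord_{x′} J′ ≤ deg F = μ`".) [cite: CossartPiltant2008, proof of Prop. 4.2 (a)] -/
theorem algebraMap_mvPolynomial_not_mem_maximalIdeal_pow (𝔮 : Ideal (MvPolynomial σ k))
    [𝔮.IsPrime] (S : Type*) [CommRing S] [Algebra (MvPolynomial σ k) S]
    [IsLocalization.AtPrime S 𝔮] [IsLocalRing S] {g : MvPolynomial σ k} (hg : g ≠ 0) {e : ℕ}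
    (he : g.totalDegree < e) :
    algebraMap (MvPolynomial σ k) S g ∉ IsLocalRing.maximalIdeal S ^ e := by
  classical
  -- the Taylor homomorphism into `S⟦Y⟧`
  let φ₁ : MvPolynomial σ k →+* MvPowerSeries σ S :=
    (MvPowerSeries.map (algebraMap (MvPolynomial σ k) S)).comp
      ((MvPolynomial.coeToMvPowerSeries.ringHom).comp
        (Taylor.shift : MvPolynomial σ k →ₐ[k] _).toRingHom)
  have hcoeff : ∀ (a : MvPolynomial σ k) (β : σ →₀ ℕ), MvPowerSeries.coeff β (φ₁ a) =
      algebraMap (MvPolynomial σ k) S (Taylor.taylorCoeff β a) := by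
    intro a β
    change MvPowerSeries.coeff β (MvPowerSeries.map (algebraMap (MvPolynomial σ k) S)
      (↑(Taylor.shift a) : MvPowerSeries σ (MvPolynomial σ k))) = _
    rw [MvPowerSeries.coeff_map, MvPolynomial.coeff_coe]
    rfl
  have hconst : ∀ a : MvPolynomial σ k,
      MvPowerSeries.constantCoeff (φ₁ a) = algebraMap (MvPolynomial σ k) S a := by
    intro a
    rw [← MvPowerSeries.coeff_zero_eq_constantCoeff_apply, hcoeff, Taylor.taylorCoeff_zero_index]
  -- elements outside `𝔮` become units of `S⟦Y⟧`, so Taylor extends to `τ̂ : S → S⟦Y⟧`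
  have hunits : ∀ s : 𝔮.primeCompl, IsUnit (φ₁ s) := fun s =>
    MvPowerSeries.isUnit_iff_constantCoeff.mpr (by rw [hconst]; exact IsLocalization.map_units S s)
  let τ : S →+* MvPowerSeries σ S := IsLocalization.lift hunits
  have hτ : ∀ a : MvPolynomial σ k, τ (algebraMap (MvPolynomial σ k) S a) = φ₁ a := fun a =>
    IsLocalization.lift_eq hunits a
  have hτconst : ∀ z : S, MvPowerSeries.constantCoeff (τ z) = z := by
    have : MvPowerSeries.constantCoeff.comp τ = RingHom.id S := by
      refine IsLocalization.ringHom_ext 𝔮.primeCompl (RingHom.ext fun a => ?_)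
      simp only [RingHom.comp_apply, RingHom.id_apply]
      rw [hτ, hconst]
    exact fun z => RingHom.congr_fun this z
  -- a top-degree exponent `β` of `g`
  obtain ⟨β, hβsupp, hβdeg⟩ : ∃ β ∈ g.support, g.totalDegree ≤ degree β := by
    obtain ⟨β, hβ, hmax⟩ :=
      Finset.exists_max_image g.support (fun s => degree s) (MvPolynomial.support_nonempty.mpr hg)
    exact ⟨β, hβ, Finset.sup_le fun s hs => hmax s hs⟩
  have hcβ : MvPolynomial.coeff β g ≠ 0 := MvPolynomial.mem_support_iff.mp hβsupp
  intro hmem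
  -- `D̂^{[β]} g ∈ (𝔮S)^{e - |β|}` …
  have key := hsComponent_mem_pow τ hτconst (IsLocalRing.maximalIdeal S) e β hmem
  -- … but `D̂^{[β]} g = coeff_{T^β} g` is a unit
  have hcomp : hsComponent τ β (algebraMap (MvPolynomial σ k) S g) =
      algebraMap (MvPolynomial σ k) S (MvPolynomial.C (MvPolynomial.coeff β g)) := by
    rw [hsComponent, hτ, hcoeff, Taylor.taylorCoeff_eq_C_coeff_of_totalDegree_le g hβdeg]
  rw [hcomp] at key
  have hunit : IsUnit (algebraMap (MvPolynomial σ k) S (MvPolynomial.C (MvPolynomial.coeff β g))) :=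
    ((isUnit_iff_ne_zero.mpr hcβ).map MvPolynomial.C).map _
  have hβle : degree β ≤ g.totalDegree := MvPolynomial.le_totalDegree hβsupp
  have hle : IsLocalRing.maximalIdeal S ^ (e - degree β) ≤ IsLocalRing.maximalIdeal S :=
    Ideal.pow_le_self (by omega)
  exact (IsLocalRing.maximalIdeal.isMaximal S).ne_top
    (Ideal.eq_top_of_isUnit_mem _ (hle key) hunit)

end Order

end Literature.AlgebraicGeometry.Resolution

end
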